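import Summits.BirchSwinnertonDyer.BirchSwinnertonDyer.Theorems.ErratumRoadFiveEulerHalfFromUB
import HarnessLib

/-!
# Route `ErratumRoadFive` (K2, `p ≥ 5`), crux `EulerHalfNotRamNoInertSetAtFive` (item stmt-BirchSwinnertonDyer-19715):
# the Euler-system half on the ¬(ram) ∧ surj pairs from UB∃♭ᴮ + the route's crux `X11aLowerHalf`, and the item's BODY

Cell `bsd-stepL` (run/shared/lean/pub/bsd-stepL/), seat `bsd-stepL-bdp` (prover g19, 2026-08-27).
`--supports stmt-BirchSwinnertonDyer-19715 --as helper`. THEOREMS ONLY; THESES-FREE. Second half of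
`Theorems/ErratumRoadFiveEulerHalfFromUB.lean` (split for the 400-line rule; see its module docstring for the typed input
UB∃♭ᴮ — H∃♭ᴮ `P2.IMCDivIntFrameOnTreeB` with the divisibility conjunct REVERSED — and the orientation).

* §3 `EulerHalfUB.missingUpperBoundAt_of_classX11b_of_not_ram_of_ubB_of_lowerX11a` — on X11b ∧ `p ≥ 5` ∧ surj ∧ ¬(ram):
  UB∃♭ᴮ at the pair + PUBLISHED facts (`h331` JSW17 Thm. 3.3.1 at a multiplicative `p`, Gross–Zagier, Kolyvagin, GZK,
  modularity ×2, Hoffstein–Luo, Mazur 1978 Cor. 4.1) + the route's crux `X11aLowerHalf` at `p` for the twist (binder `h₃`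
  of K2's `closes`; the twist of a ¬(ram) pair by a classical Heegner field is an X11a pair, `classX11a_twist_of_not_ram`;
  its lower half in print shape by `AdditivePotMult.exists_printShape_lower_of_missingLowerBoundAt_rankZero`) ⟹
  `Typed.MissingUpperBoundAt W p`. The UB road's form of the tree's `missingUpperBoundAt_of_classX11b_of_not_ram_of_lowerX11a`
  (Kolyvagin + X11a, which needs `p ∤ ∏c`): here NO Tamagawa condition.
* §4 `EulerHalfUB.eulerHalfNotRamNoInertSet_body_of_ubB_of_lowerX11a` — the BODY of item 19715
  `EulerHalfNotRamNoInertSetAtFive` VERBATIM (its inert-set exclusion and `p ∣ ∏c` are not used) from UB∃♭ᴮ on the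
  ¬(ram) pairs + `X11aLowerHalf` + the published facts: A ROAD for the 404-pair residual (334 split-only + 70
  three-prime, kit j254667; «only suppliers Kato + Schneider or an 𝓛-invariant road», item text) that needs NO `p`-adic
  height and NO Shimura curve. By-name wrapper: `Theorems/ErratumRoadFiveEulerHalfNotRamNoInertSetOfUB.lean`.

HONEST FRAMING: implications only. UB∃♭ᴮ is OPEN in print at every `p ∣ N` (lit g19 EPS3-SOURCES §E.1); the cell holds
the underlying divisibility «`L_𝔭 ∈ Ch_Λ(X_ac 𝔭bar)·Λ_{R₀}`» at MEMO grade only (PROOF-BDP §38.8/§38.10/§39 non-split,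
§41 split; referee PASS on §38/38.8/38.9, the rest owed). `X11aLowerHalf` is an OPEN crux. Nothing is discharged,
booked or re-labelled (T7); BSD is proved for no pair; item 19715 is NOT closed.

References: [JetchevSkinnerWan2017] Thm. 3.3.1, §7.4.2 (arXiv:1512.06894 pp. 11, 31); [Castella2018] Thms. 2.3, 3.1,
3.2, §5 (arXiv:1704.06608 pp. 5, 9, 12); [HoffsteinLuo1997]; [Mazur1978] Cor. 4.1; [Miller2011LMS] Def. 1.1.
-/

set_option autoImplicit false
set_option linter.dupNamespace false

noncomputable section

open scoped Classical NumberField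

open WeierstrassCurve NumberField IsDedekindDomain Field PowerSeries
open Literature.NumberTheory.EllipticCurves Literature.NumberTheory.EllipticCurves.GreenbergSelmer
open Literature.NumberTheory.EllipticCurves.ModularForms
open Literature.NumberTheory.EllipticCurves.Rank1Residual
open Literature.NumberTheory.EllipticCurves.Rank1Residual.Typed
open Literature.NumberTheory.EllipticCurves.JetchevSkinnerWan2017
open Literature.NumberTheory.GaloisRepresentations Literature.NumberTheory.GaloisCohomology
open Literature.NumberTheory.Automorphic
open Summit.BirchSwinnertonDyer.Rank1Residual Summit.BirchSwinnertonDyer.Rank1Residual.X11b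
open Summit.BirchSwinnertonDyer.Rank1Residual.X11b.AcSelmer
open Summit.BirchSwinnertonDyer.Rank1Residual.X11b.Halves

namespace Summit.BirchSwinnertonDyer.BirchSwinnertonDyer.Theorems.EulerHalfUB

/-! ### §3 Class X11b ∧ surj ∧ ¬(ram): the Euler-system half from UB∃♭ᴮ + crux `X11aLowerHalf` for the twist -/

section NotRam

/-- **The Euler-system half `Typed.MissingUpperBoundAt W p` on X11b ∧ `p ≥ 5` ∧ surj ∧ ¬(ram) from UB∃♭ᴮ at the
pair, PUBLISHED facts, and the main-conjecture half on the rank-`0` sister class X11a at `p` for the twist** (`hX11a`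
= the route's crux `X11aLowerHalf` read at `p`, binder `h₃` of K2's `closes`; the twist `E^{d_K}` of a ¬(ram) X11b
pair by a classical Heegner field is an X11a pair — `r_an = 0`, multiplicative and irreducible at `p`, ¬(ram) —,
`classX11a_twist_of_not_ram`; its lower half is put in print shape by
`AdditivePotMult.exists_printShape_lower_of_missingLowerBoundAt_rankZero`). The rest as in §2. This is the UB road's
form of the tree's `missingUpperBoundAt_of_classX11b_of_not_ram_of_lowerX11a` (Kolyvagin + X11a, which needs
`p ∤ ∏c`): here NO Tamagawa condition. CONDITIONAL on UB∃♭ᴮ and `X11aLowerHalf`; nothing booked.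
[cite: JetchevSkinnerWan2017, Thm. 3.3.1 and §7.4.2 (arXiv:1512.06894 pp. 11, 31)]
[cite: HoffsteinLuo1997, Theorem (§1)] [cite: Mazur1978, Cor. 4.1]
[cite: Castella2018, Thms. 2.3, 3.1, 3.2 (arXiv:1704.06608 pp. 5, 9)] [cite: Miller2011LMS, Def. 1.1] -/
theorem missingUpperBoundAt_of_classX11b_of_not_ram_of_ubB_of_lowerX11a
    (h331 : thm331_anticyclotomicControl_mult)
    (hGZ : ∀ (N : ℕ) [NeZero N] (W : WeierstrassCurve ℚ) (K : Type) [Field K] [NumberField K],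
      gross_zagier N W K)
    (hKo : ∀ (N : ℕ) [NeZero N] (W : WeierstrassCurve ℚ) (K : Type) [Field K] [NumberField K],
      kolyvagin N W K)
    (hGZK : rank_eq_analyticRank_of_analyticRank_le_one) (hmod : hasEntireLFunction_rat)
    (hnf : exists_isNewformOf) (hHL : HoffsteinLuo1997_exists_twist_L_one_ne_zero)
    (hMaz : mazur_not_dvd_maninConstant_of_odd)
    (W : WeierstrassCurve ℚ) [W.IsElliptic] [W.IsGloballyMinimal] (p : ℕ) [Fact p.Prime]
    (hX : ClassX11b W p) (hp5 : 5 ≤ p) (hsurj : Surj W p) (hnram : ¬ Ram W p)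
    -- UB∃♭ᴮ at the pair
    (hUB : ∀ (N : ℕ) [NeZero N] (K : Type) [Field K] [NumberField K]
      (Dt : ModularParametrizationData W N) (H : HeegnerDatum N (NumberField.discr K)) (ι : K →+* ℂ)
      (P : (W.baseChange K).toAffine.Point),
      ClassX11b W p → 5 ≤ p → Surj W p → W.conductorNorm ℤ = N → IsImaginaryQuadratic K →
      Odd (NumberField.discr K) → ¬ (p : ℤ) ∣ NumberField.discr K → ¬ p ∣ Units.torsionOrder K →
      SatisfiesHeegnerHypothesis N K →
      (W.quadraticTwist (NumberField.discr K : ℚ)).entireLFunction 1 ≠ 0 →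
      WeierstrassCurve.Affine.Point.map ι.toRatAlgHom P = heegnerPointComplex Dt H →
      ¬ (p : ℤ) ∣ Dt.c → ¬ IsOfFinAddOrder P →
      ∀ (κ : ZpExtension K p), κ.IsAnticyclotomic →
        ∀ (γ : Field.absoluteGaloisGroup K) [Fact (κ.IsTopGenerator γ)]
          (ι' : PadicAlgCl p ≃+* ℂ) (w₀ : InfinitePlace K) (P' : (W.baseChange K).toAffine.Point),
          WeierstrassCurve.Affine.Point.map w₀.embedding.toRatAlgHom P' = heegnerPointComplex Dt H →
          ∀ (e : K →+* ℚ_[p]),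
            (∀ k : 𝓞 K, k ∈ (primeOfEmbeddingDatum p ι' w₀.embedding).asIdeal ↔ ‖e (k : K)‖ < 1) →
            ∃ (ΩK : ℂ) (Ωp : ℂ_[p]) (Q : PowerSeries 𝓞_ℂ_[p]), ΩK ≠ 0 ∧ ‖Ωp‖ = 1 ∧
              R1.IsBDPLFunctionInt p ι' (primeOfEmbeddingDatum p ι' w₀.embedding) κ γ Dt.f ΩK Ωp Q ∧
              R1.BDPValueAtOneIntAt W p e P' Q (W.LFunction p) ∧
              ∀ (𝔭bar : HeightOneSpectrum (𝓞 K)), ((p : ℕ) : 𝓞 K) ∈ 𝔭bar.asIdeal →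
                𝔭bar ≠ primeOfEmbeddingDatum p ι' w₀.embedding →
                Ideal.span {Q} ≤
                  (XAc.charIdeal (W.baseChange K) p κ 𝔭bar ∅ γ).map (PowerSeries.map (R1.toCpInt p)))
    -- (T3) the main-conjecture half on the rank-0 sister class X11a at `p` (crux `X11aLowerHalf`)
    (hX11a : ∀ (Wd : WeierstrassCurve ℚ) [Wd.IsElliptic] [Wd.IsGloballyMinimal],
      ClassX11a Wd p → Typed.MissingLowerBoundAt Wd p) :
    Typed.MissingUpperBoundAt W p := by
  have hNS : integral_neronScaling_of_isGloballyMinimal := integral_neronScaling_of_isGloballyMinimal_holds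
  have hX' := hX
  obtain ⟨hr, hp2, hmult, hirr⟩ := hX
  haveI : NeZero (W.conductorNorm ℤ) := ⟨(W.conductorNorm_pos_holds).ne'⟩
  obtain ⟨K, _, _, Dt, H, ι, P, Wd, _, _, Cd, hK, hodd, hpd, hHN, hP, hc, hμ, hLt, hWd⟩ :=
    exists_oddHeegnerData hnf hHL hMaz hNS W p hr hp2 hmult hirr
  -- the twist on its minimal model is an X11a pair; its lower half in print shape
  have hD0 : (NumberField.discr K : ℚ) ≠ 0 := by exact_mod_cast NumberField.discr_ne_zero K
  haveI hEt : (W.quadraticTwist (NumberField.discr K : ℚ)).IsElliptic := W.isElliptic_quadraticTwist hD0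
  have hirrd : Wd.HasIrreducibleModPGaloisRep p :=
    hasIrreducibleModPGaloisRep_twist_model W p K hK.1 hirr Cd hWd
  have hLt' : (W.quadraticTwist (NumberField.discr K : ℚ)).entireLFunction = Wd.entireLFunction := by
    rw [← hWd, entireLFunction_smul]
  have hLd1 : Wd.entireLFunction 1 ≠ 0 := by rw [← hLt']; exact hLt
  have hrd : Wd.analyticRank = 0 := (Wd.analyticRank_eq_zero_iff_holds (hmod Wd)).2 hLd1
  have hXa : ClassX11a Wd p := classX11a_twist_of_not_ram W p hX' hnram K hK hHN Cd hWd hrd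
  have htw := AdditivePotMult.exists_printShape_lower_of_missingLowerBoundAt_rankZero (p := p) Wd hGZK hrd hirrd
    (hX11a Wd hXa)
  have hPinf : ¬ IsOfFinAddOrder P :=
    not_isOfFinAddOrder_of_heegner_of_analyticRank_eq_one W _ K Dt H ι P (hGZ _ W K) hmod hr hK hHN hLt hP
  exact missingUpperBoundAt_of_shaIndexBoundSharp_of_odd W p K Dt H ι P (hGZ _ W K) (hKo _ W K) hGZK hmod
    hr hp2 hmult hK hodd hpd hHN hP hc hμ hLt Wd Cd hWd htw
    (fun _ _ ↦ shaIndexBoundSharp_of_ubB_at_datum h331 hKo hUB _ K Dt H ι P hX' hp5 hsurj rfl hK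
      hodd hpd hμ hHN hLt hP hc hPinf)

end NotRam

/-! ### §4 The body of item 19715 from UB∃♭ᴮ on the ¬(ram) pairs + `X11aLowerHalf` -/

section Item

/-- **Item 19715 `EulerHalfNotRamNoInertSetAtFive`, BODY VERBATIM, from UB∃♭ᴮ on the ¬(ram) X11b pairs (`hUBnr`,
the shape of §1 under the extra binder `¬ Ram W p` — the UB|¬ram of the 19282 line cards) + the route's crux
`X11aLowerHalf` (`hX11a`, all `p`) + PUBLISHED facts.** The item's last two binders (`p ∣ ∏c`, the inert-set
exclusion) are NOT used: the UB road is uniform in the Tamagawa numbers and needs no Shimura curve, so it covers the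
404-pair residual (334 split-only + 70 three-prime, kit j254667) together with everything the inert line already
reaches. A ROAD, not a closure: CONDITIONAL on UB∃♭ᴮ (memo grade) and `X11aLowerHalf` (open crux); nothing booked;
the by-name wrapper is `Theorems/ErratumRoadFiveEulerHalfNotRamNoInertSetOfUB.lean`.
[cite: JetchevSkinnerWan2017, Thm. 3.3.1 and §7.4.2 (arXiv:1512.06894 pp. 11, 31)]
[cite: Castella2018, Thms. 2.3, 3.1, 3.2 (arXiv:1704.06608 pp. 5, 9)] [cite: Miller2011LMS, Def. 1.1] -/
theorem eulerHalfNotRamNoInertSet_body_of_ubB_of_lowerX11a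
    (h331 : thm331_anticyclotomicControl_mult)
    (hGZ : ∀ (N : ℕ) [NeZero N] (W : WeierstrassCurve ℚ) (K : Type) [Field K] [NumberField K],
      gross_zagier N W K)
    (hKo : ∀ (N : ℕ) [NeZero N] (W : WeierstrassCurve ℚ) (K : Type) [Field K] [NumberField K],
      kolyvagin N W K)
    (hGZK : rank_eq_analyticRank_of_analyticRank_le_one) (hmod : hasEntireLFunction_rat)
    (hnf : exists_isNewformOf) (hHL : HoffsteinLuo1997_exists_twist_L_one_ne_zero)
    (hMaz : mazur_not_dvd_maninConstant_of_odd)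
    -- UB∃♭ᴮ on the ¬(ram) pairs
    (hUBnr : ∀ (W : WeierstrassCurve ℚ) [W.IsElliptic] [W.IsGloballyMinimal] (p : ℕ) [Fact p.Prime],
      ¬ Ram W p →
      ∀ (N : ℕ) [NeZero N] (K : Type) [Field K] [NumberField K]
      (Dt : ModularParametrizationData W N) (H : HeegnerDatum N (NumberField.discr K)) (ι : K →+* ℂ)
      (P : (W.baseChange K).toAffine.Point),
      ClassX11b W p → 5 ≤ p → Surj W p → W.conductorNorm ℤ = N → IsImaginaryQuadratic K →
      Odd (NumberField.discr K) → ¬ (p : ℤ) ∣ NumberField.discr K → ¬ p ∣ Units.torsionOrder K →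
      SatisfiesHeegnerHypothesis N K →
      (W.quadraticTwist (NumberField.discr K : ℚ)).entireLFunction 1 ≠ 0 →
      WeierstrassCurve.Affine.Point.map ι.toRatAlgHom P = heegnerPointComplex Dt H →
      ¬ (p : ℤ) ∣ Dt.c → ¬ IsOfFinAddOrder P →
      ∀ (κ : ZpExtension K p), κ.IsAnticyclotomic →
        ∀ (γ : Field.absoluteGaloisGroup K) [Fact (κ.IsTopGenerator γ)]
          (ι' : PadicAlgCl p ≃+* ℂ) (w₀ : InfinitePlace K) (P' : (W.baseChange K).toAffine.Point),
          WeierstrassCurve.Affine.Point.map w₀.embedding.toRatAlgHom P' = heegnerPointComplex Dt H →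
          ∀ (e : K →+* ℚ_[p]),
            (∀ k : 𝓞 K, k ∈ (primeOfEmbeddingDatum p ι' w₀.embedding).asIdeal ↔ ‖e (k : K)‖ < 1) →
            ∃ (ΩK : ℂ) (Ωp : ℂ_[p]) (Q : PowerSeries 𝓞_ℂ_[p]), ΩK ≠ 0 ∧ ‖Ωp‖ = 1 ∧
              R1.IsBDPLFunctionInt p ι' (primeOfEmbeddingDatum p ι' w₀.embedding) κ γ Dt.f ΩK Ωp Q ∧
              R1.BDPValueAtOneIntAt W p e P' Q (W.LFunction p) ∧
              ∀ (𝔭bar : HeightOneSpectrum (𝓞 K)), ((p : ℕ) : 𝓞 K) ∈ 𝔭bar.asIdeal →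
                𝔭bar ≠ primeOfEmbeddingDatum p ι' w₀.embedding →
                Ideal.span {Q} ≤
                  (XAc.charIdeal (W.baseChange K) p κ 𝔭bar ∅ γ).map (PowerSeries.map (R1.toCpInt p)))
    -- (T3) the main-conjecture half on the rank-0 sister class X11a (crux `X11aLowerHalf`, every `p`)
    (hX11a : ∀ (Wd : WeierstrassCurve ℚ) [Wd.IsElliptic] [Wd.IsGloballyMinimal] (p : ℕ) [Fact p.Prime],
      ClassX11a Wd p → Typed.MissingLowerBoundAt Wd p) :
    ∀ (W : WeierstrassCurve ℚ) [W.IsElliptic] [W.IsGloballyMinimal] (p : ℕ) [Fact p.Prime],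
      ClassX11b W p → 5 ≤ p → Surj W p → ¬ Ram W p → p ∣ W.tamagawaProduct →
      ¬ (∃ S : Finset ℕ, (∀ ℓ ∈ S, ∃ _ : Fact ℓ.Prime, Mult W ℓ) ∧ Even S.card ∧ p ∈ S ∧
          (∀ (ℓ : ℕ) [Fact ℓ.Prime], ℓ ∉ S → W.HasSplitMultiplicativeReductionAtPrime ℓ →
            ¬ p ∣ padicValInt ℓ W.minimalDiscriminantInt) ∧
          (¬ p ∣ padicValInt p W.minimalDiscriminantInt ∨
            ∃ R ⊆ S, S.card = 2 * R.card ∧ ∀ q ∈ R, q ≠ 2 ∧ ¬ p ∣ q - 1)) →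
      Typed.MissingUpperBoundAt W p := by
  intro W _ _ p _ hX hp5 hsurj hnram _ _
  exact missingUpperBoundAt_of_classX11b_of_not_ram_of_ubB_of_lowerX11a h331 hGZ hKo hGZK hmod hnf hHL hMaz W p
    hX hp5 hsurj hnram (hUBnr W p hnram) (fun Wd _ _ hXa ↦ hX11a Wd p hXa)

end Item

end Summit.BirchSwinnertonDyer.BirchSwinnertonDyer.Theorems.EulerHalfUB

end
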